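/-
NEW (pub-hodgecm2, COR-CM cell = stage 2 of the Hodge ladder; binder prover b12, row M21 of `HOME/BINDER-OWNERS.md`,
lead RULING R7(a) «M21-1L»).  Not a port: the named one-line junction discharging row M21 `Fact_conjIsogeny` of the
Picard–CM model universe over the DISPLAYED binders `hHD hI hU h₃` and stage 1's cited record `hR` (B02) only.
-/
import Summits.HodgeConjecture.CorCM.Model.ModelFacts
import Literature.AlgebraicGeometry.ComplexMultiplication.ShimuraIsogenyOfRiemann
import HarnessLib

/-!
# COR-CM — row M21 `Fact_conjIsogeny` of the Picard–CM model universe from Riemann's theorem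

For `U₀ := Model.universeOf hHD hI hU h₃` (`CorCM/Model/Universe.lean`), model-1's junction theorem
`Model.universeOf_conjIsogeny` (`CorCM/Model/ModelFacts.lean`) discharges the field `Fact_conjIsogeny` of `U₀.ModelAxioms`
modulo Shimura 1998 §6.1, Corollary of Theorem 2 (`ComplexMultiplication.Shimura1998_Thm2_Cor`: two abelian varieties of the
same CM type are `𝓞_K`-equivariantly isogenous).  That corollary is a tree THEOREM from Riemann's theorem
(`ComplexMultiplication.thm2_cor_of_riemann : DeligneMilne1982_Thm_6_20_full → Shimura1998_Thm2_Cor`,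
`Literature/AlgebraicGeometry/ComplexMultiplication/ShimuraIsogenyOfRiemann.lean`), so row M21 is discharged by ONE named theorem
of EXACTLY the row type over the displayed binders `hHD hI hU h₃` and `hR : DeligneMilne1982_Thm_6_20_full` (stage 1's cited
binder B02, displayed in both TOP statements of `CorCM/Interfaces.lean`).  This is the term already used for the field
`conjIsogeny` inside `Model.modelAxioms_of_rows` (`CorCM/Model/ModelAxiomsOfRows.lean`), given a name (referee count rule C3 /
R7-2: strict named junction).

Nothing is asserted: no definition, no named fact; axioms ⊆ {propext, Classical.choice, Quot.sound}.
-/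

noncomputable section

namespace Summit.HodgeConjecture.CorCM

open Literature.NumberTheory.Automorphic.PicardCM
open Literature.AlgebraicGeometry.HodgeTheory
open Literature.AlgebraicGeometry.ComplexMultiplication (thm2_cor_of_riemann)

namespace Model

/-- **Row M21 `Fact_conjIsogeny` of the Picard–CM model universe, from Riemann's theorem.**  For the model universe
`universeOf hHD hI hU h₃`, complex-conjugate CM types `Φ`, `Φ'` of a CM field `K` (`φ ∈ Φ' ↔ φ̄ ∈ Φ`) have coded realisations
related by an `𝓞_K`-semilinear (along complex conjugation `c : K ≃+* K`) isogeny read on `H¹` — the field `Fact_conjIsogeny` of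
`ModelAxioms` — over the displayed binders only: model-1's `universeOf_conjIsogeny` (modulo Shimura 1998 §6.1 Cor. of Thm 2)
composed with the tree theorem `thm2_cor_of_riemann hR` (that corollary from Deligne–Milne 1982 Thm 6.20 = Riemann's theorem,
stage 1's cited binder B02). -/
theorem universeOf_conjIsogeny_of_riemann (hHD : exists_isReal_hodgeModel)
    (hI : hodgePQ_independent_of_hodgeModel) (hU : BallQuotientUniformisedDatum)
    (h₃ : CMAbelianVarietyRealised) (hR : DeligneMilne1982_Thm_6_20_full) :
    (universeOf hHD hI hU h₃).Fact_conjIsogeny :=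
  universeOf_conjIsogeny hHD hI hU h₃ (thm2_cor_of_riemann hR)

/-- Row M21 for the model of record `picardCMUniverse hHD hI h₁ h₃`
(`= universeOf hHD hI (ballQuotientUniformisedDatum_of h₁) h₃` by `rfl`), from Riemann's theorem. -/
theorem picardCMUniverse_conjIsogeny_of_riemann (hHD : exists_isReal_hodgeModel)
    (hI : hodgePQ_independent_of_hodgeModel) (h₁ : BallQuotientUniformised)
    (h₃ : CMAbelianVarietyRealised) (hR : DeligneMilne1982_Thm_6_20_full) :
    (picardCMUniverse hHD hI h₁ h₃).Fact_conjIsogeny :=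
  universeOf_conjIsogeny_of_riemann hHD hI (ballQuotientUniformisedDatum_of h₁) h₃ hR

end Model

end Summit.HodgeConjecture.CorCM

end
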